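import Literature.MathematicalPhysics.QuantumLattice.TorusLimitSectorGroundStatesChargedRows
import Literature.MathematicalPhysics.QuantumLattice.TwoChemicalPotentialGroundStatesAreGaugeInvariant
import HarnessLib

/-!
# At a density with a charge gap, translation-invariant minimisers and torus limits of ground-state
# families of the `t–t'` Hubbard model are gauge invariant (no pair amplitude)

Topic `Literature/MathematicalPhysics/QuantumLattice` (namespace = path). Family `hubbard`, crew hubbard-obs,
seat `hubbard-obs-gs-2` g4. Everything is PROVED (std axioms, no `sorry`, no definition, no named fact).

This file joins two tree theorems:
* `IsTranslationInvariant.isGroundState_hubbardTTPrimeMu_of_mem_Icc` (`TorusLimitSectorGroundStatesChargedRows`,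
  Bratteli–Kishimoto–Robinson `2 ⇒ 1` + the chord inequality): a translation-invariant state of density
  `n ∈ (0,2)` and mean energy `e(t,t',U,n)` (`U ≥ 0`) — i.e. a translation-invariant CANONICAL MINIMISER — is a
  Bratteli–Robinson ground state of `H^{tt'} − μN` for EVERY `μ` of the subdifferential `[μ₋(n), μ₊(n)]`;
* `IsTranslationInvariant.isGaugeInvariant_of_isGroundState_hubbardTTPrimeMu_two`
  (`TwoChemicalPotentialGroundStatesAreGaugeInvariant`): a translation-invariant ground state at TWO chemical
  potentials is gauge invariant;
into: **if `μ₋(n) < μ₊(n)` (a charge gap at density `n`), every translation-invariant state of density `n` and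
mean energy `e(n)` is gauge invariant** (`isGaugeInvariant_of_meanEnergy_eq_of_chemPot_lt`), hence has zero
singlet-pair amplitude for every form factor (`expect_localPairAt_eq_zero_of_meanEnergy_eq_of_chemPot_lt`); and
so is every torus limit of an asymptotically-ground-state family at density `n`
(`IsTorusLimitOf.isGaugeInvariant_of_asymptoticGroundStates_of_chemPot_lt`), in particular of every family of unit
`(rectN n L, S^z = 0)`-sector ground states (`…_of_sectorGroundStates_of_chemPot_lt`). In Lieb–Wu's words
(«the system is insulating if `μ₊ > μ₋`»): an insulating density of the 2D `t–t'` Hubbard model carries no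
`U(1)`-breaking (superconducting) order in any translation-invariant ground state — the lattice-fermion form of
«BEC ⇒ no cusp of `e(ρ)`» (Lieb–Seiringer–Solovej–Yngvason 2005 §11.3, hard-core bosons).

HONEST SCOPE: structure theorems about infinite-volume states; no density is shown to HAVE a charge gap; no
number, no certificate.

References: E. H. Lieb, F. Y. Wu, Physica A 321 (2003) 1–27, §7 [LiebWuPhysicaA2003]; O. Bratteli, A. Kishimoto,
D. W. Robinson, Commun. Math. Phys. 64 (1978) 41–48, Thm. 2 [BratteliKishimotoRobinson1978]; O. Bratteli,
D. W. Robinson, *OAQSM 2* (1997) Prop. 5.3.19, §5.2.2 [BratteliRobinsonII1997]; E. H. Lieb, R. Seiringer,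
J. P. Solovej, J. Yngvason (2005) §11.3 eq. (11.29)–(11.30) [LSSY2005]; T. Koma, H. Tasaki, J. Stat. Phys. 76
(1994) 745, §2.2 [KomaTasaki1994].
-/

noncomputable section

namespace Literature.MathematicalPhysics.QuantumLattice

open _root_.Matrix Finset HubbardWave0 Literature.Probability.LatticeModels _root_.Filter ThermodynamicLimit
open scoped _root_.Topology ComplexOrder

namespace InfVolFermionState

section Minimisers

variable {ω : InfVolFermionState 2}

/-- **A translation-invariant canonical minimiser at a density with a charge gap is gauge invariant**:
`U ≥ 0`, `0 < n < 2`, `ω` translation invariant with density `n` and mean energy `e(t,t',U,n)`, and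
`μ₋(n) < μ₊(n)` ⇒ `ω ∘ γ_θ = ω`. [cite: LiebWuPhysicaA2003, §7] [cite: BratteliKishimotoRobinson1978, Thm. 2 (p. 47)]
[cite: BratteliRobinsonII1997, Prop. 5.3.19 and §5.2.2] -/
theorem IsTranslationInvariant.isGaugeInvariant_of_meanEnergy_eq_of_chemPot_lt (t t' : ℝ) {U n : ℝ}
    (hU : 0 ≤ U) (hn0 : 0 < n) (hn2 : n < 2) (hω : ω.IsTranslationInvariant) (hρ : ω.density = n)
    (hme : ω.meanEnergy (hubbardTTPrimeFermionInteraction t t' U) 1 = energyDensityTT' t t' U n)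
    (hgap : chemPotMinusTT' t t' U n < chemPotPlusTT' t t' U n) : ω.IsGaugeInvariant :=
  hω.isGaugeInvariant_of_isGroundState_hubbardTTPrimeMu_two t t' U hgap
    (hω.isGroundState_hubbardTTPrimeMu_of_mem_Icc t t' hU hn0 hn2 hρ hme ⟨le_rfl, hgap.le⟩)
    (hω.isGroundState_hubbardTTPrimeMu_of_mem_Icc t t' hU hn0 hn2 hρ hme ⟨hgap.le, le_rfl⟩)

/-- The same with the charge gap `Δ_c(n) = μ₊(n) − μ₋(n) > 0` as hypothesis. [cite: LiebWuPhysicaA2003, §7] -/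
theorem IsTranslationInvariant.isGaugeInvariant_of_meanEnergy_eq_of_chargeGap_pos (t t' : ℝ) {U n : ℝ}
    (hU : 0 ≤ U) (hn0 : 0 < n) (hn2 : n < 2) (hω : ω.IsTranslationInvariant) (hρ : ω.density = n)
    (hme : ω.meanEnergy (hubbardTTPrimeFermionInteraction t t' U) 1 = energyDensityTT' t t' U n)
    (hgap : 0 < chargeGapTT' t t' U n) : ω.IsGaugeInvariant :=
  hω.isGaugeInvariant_of_meanEnergy_eq_of_chemPot_lt t t' hU hn0 hn2 hρ hme
    (by rw [chargeGapTT'_def] at hgap; linarith)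

/-- **… hence no pair amplitude**: `ω(P_x^g) = 0` for the singlet pair operator `localPairAt S g x` of every form
factor, in every translation-invariant canonical minimiser at a density with a charge gap.
[cite: LiebWuPhysicaA2003, §7] [cite: LSSY2005, §11.3 eq. (11.29)–(11.30)] -/
theorem IsTranslationInvariant.expect_localPairAt_eq_zero_of_meanEnergy_eq_of_chemPot_lt (t t' : ℝ) {U n : ℝ}
    (hU : 0 ≤ U) (hn0 : 0 < n) (hn2 : n < 2) (hω : ω.IsTranslationInvariant) (hρ : ω.density = n)
    (hme : ω.meanEnergy (hubbardTTPrimeFermionInteraction t t' U) 1 = energyDensityTT' t t' U n)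
    (hgap : chemPotMinusTT' t t' U n < chemPotPlusTT' t t' U n) (S : Finset (Site 2)) (g : Site 2 → ℝ)
    (x : Site 2) : ω.expect (pairRegion S x) (localPairAt S g x) = 0 :=
  (hω.isGaugeInvariant_of_meanEnergy_eq_of_chemPot_lt t t' hU hn0 hn2 hρ hme hgap).expect_localPairAt_eq_zero S g x

/-- **… and no charged expectation at all** (`q ≠ 0`). [cite: BratteliRobinsonII1997, §5.2.2] -/
theorem IsTranslationInvariant.expect_eq_zero_of_hasGaugeCharge_of_meanEnergy_eq_of_chemPot_lt (t t' : ℝ)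
    {U n : ℝ} (hU : 0 ≤ U) (hn0 : 0 < n) (hn2 : n < 2) (hω : ω.IsTranslationInvariant) (hρ : ω.density = n)
    (hme : ω.meanEnergy (hubbardTTPrimeFermionInteraction t t' U) 1 = energyDensityTT' t t' U n)
    (hgap : chemPotMinusTT' t t' U n < chemPotPlusTT' t t' U n) {Λ : Finset (Site 2)} {q : ℤ} (hq : q ≠ 0)
    {A : FermionOp Λ} (hA : HasGaugeCharge q A) : ω.expect Λ A = 0 :=
  (hω.isGaugeInvariant_of_meanEnergy_eq_of_chemPot_lt t t' hU hn0 hn2 hρ hme hgap).expect_eq_zero_of_hasGaugeCharge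
    hq hA

end Minimisers

section TorusLimits

variable {ω : InfVolFermionState 2} {ψ : ∀ L, Fock (Orb (FermionTorus 2 L))} {Ls : ℕ → ℕ}

/-- **Torus limits of asymptotically-ground-state families at a density with a charge gap are gauge invariant.**
For ANY family of torus vectors `ψ_{L_j}` (not necessarily eigenvectors, mixed particle number allowed) with number
densities `→ n ∈ (0,2)` and energies per site eventually `≤ e(t,t',U,n) + ε` (`U ≥ 0`), if `μ₋(n) < μ₊(n)` then
every torus limit `ω` is gauge invariant. [cite: KomaTasaki1994, §2.2] [cite: BratteliKishimotoRobinson1978, Thm. 2 (p. 47)]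
[cite: LiebWuPhysicaA2003, §7] -/
theorem IsTorusLimitOf.isGaugeInvariant_of_asymptoticGroundStates_of_chemPot_lt (t t' : ℝ) {U n : ℝ}
    (hU : 0 ≤ U) (hn0 : 0 < n) (hn2 : n < 2) (h : ω.IsTorusLimitOf ψ Ls) (hLs : Tendsto Ls atTop atTop)
    (hN : Tendsto (fun j => (∑ σ : Fin 2,
        (star (ψ (Ls j)) ⬝ᵥ ((∑ y : FermionTorus 2 (Ls j), numberOp y σ) *ᵥ ψ (Ls j))).re) / ((Ls j : ℝ)) ^ 2)
      atTop (𝓝 n))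
    (hE : ∀ ε : ℝ, 0 < ε → ∀ᶠ j in atTop,
      (star (ψ (Ls j)) ⬝ᵥ (hubbardTorusTT' (Ls j) t t' U *ᵥ ψ (Ls j))).re / (Ls j : ℝ) ^ 2 ≤
        energyDensityTT' t t' U n + ε)
    (hgap : chemPotMinusTT' t t' U n < chemPotPlusTT' t t' U n) : ω.IsGaugeInvariant := by
  obtain ⟨hTI, hρ, hme, -⟩ := h.canonicalMinimiser_of_asymptoticGroundStates t t' hU hn0 hn2 hLs hN hE
  exact hTI.isGaugeInvariant_of_meanEnergy_eq_of_chemPot_lt t t' hU hn0 hn2 hρ hme hgap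

/-- **Sector ground states**: if `μ₋(n) < μ₊(n)`, every torus limit of unit `(rectN n L, S^z = 0)`-sector ground
states of `hubbardTorusTT' L t t' U` (`U ≥ 0`, `0 < n < 2`) along `L_j → ∞` is gauge invariant — in particular it
has zero pair amplitude for every form factor. [cite: KomaTasaki1994, §2.2] [cite: LiebWuPhysicaA2003, §7] -/
theorem IsTorusLimitOf.isGaugeInvariant_of_sectorGroundStates_of_chemPot_lt (t t' : ℝ) {U n : ℝ} (hU : 0 ≤ U)
    (hn0 : 0 < n) (hn2 : n < 2) (h : ω.IsTorusLimitOf ψ Ls) (hLs : Tendsto Ls atTop atTop)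
    (hψ : ∀ j, IsGroundStateInSector (hubbardTorusTT' (Ls j) t t' U) (rectN n (Ls j)) 0 (ψ (Ls j)))
    (hψ1 : ∀ j, star (ψ (Ls j)) ⬝ᵥ ψ (Ls j) = 1)
    (hgap : chemPotMinusTT' t t' U n < chemPotPlusTT' t t' U n) : ω.IsGaugeInvariant := by
  obtain ⟨hN, hE⟩ := tendsto_number_energy_of_sectorGroundStates t t' hU hn0.le hn2 hLs hψ hψ1
  exact h.isGaugeInvariant_of_asymptoticGroundStates_of_chemPot_lt t t' hU hn0 hn2 hLs hN hE hgap

/-- The pair-amplitude form of the previous theorem. [cite: KomaTasaki1994, §2.2] [cite: LiebWuPhysicaA2003, §7] -/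
theorem IsTorusLimitOf.expect_localPairAt_eq_zero_of_sectorGroundStates_of_chemPot_lt (t t' : ℝ) {U n : ℝ}
    (hU : 0 ≤ U) (hn0 : 0 < n) (hn2 : n < 2) (h : ω.IsTorusLimitOf ψ Ls) (hLs : Tendsto Ls atTop atTop)
    (hψ : ∀ j, IsGroundStateInSector (hubbardTorusTT' (Ls j) t t' U) (rectN n (Ls j)) 0 (ψ (Ls j)))
    (hψ1 : ∀ j, star (ψ (Ls j)) ⬝ᵥ ψ (Ls j) = 1)
    (hgap : chemPotMinusTT' t t' U n < chemPotPlusTT' t t' U n) (S : Finset (Site 2)) (g : Site 2 → ℝ)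
    (x : Site 2) : ω.expect (pairRegion S x) (localPairAt S g x) = 0 :=
  (h.isGaugeInvariant_of_sectorGroundStates_of_chemPot_lt t t' hU hn0 hn2 hLs hψ hψ1 hgap).expect_localPairAt_eq_zero
    S g x

end TorusLimits

end InfVolFermionState

end Literature.MathematicalPhysics.QuantumLattice

end
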